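import Mathlib.Algebra.CharZero.Infinite
import Mathlib.RingTheory.MvPolynomial.Basic
import Mathlib.LinearAlgebra.Dual.Lemmas
import Literature.Computability.AlgebraicComplexity.OrbitClosureWeights
import Literature.Computability.AlgebraicComplexity.PlethysmLifting
import Literature.NumberTheory.DiophantineGeometry.SchurWeylPlethysm
import HarnessLib

/-!
# Highest weights of `k[Δ(det_m)]` are duals of partitions — discharge of
# `exists_eq_toMatIdx_of_hasHighestWeight_detOrbitRep`

The named fact `Literature.NumberTheory.DiophantineGeometry.exists_eq_toMatIdx_of_hasHighestWeight_detOrbitRep` of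
`SchurWeylPlethysm.lean` (BLMW 2011 §5.2, (5.2.2): every highest weight of the coordinate ring of
the orbit closure of `det_m` is `(Weight.dualOfPartition (m*m) λ).toMatIdx` for a partition
`λ ⊢ m·d` with at most `m²` parts) is the special case `f = det_m` of the general theorem
`exists_eq_dualOfPartition_of_hasHighestWeight_orbitCoordRep` of `OrbitClosureWeights.lean`
(proved there on the orbit over any infinite field, without complete reducibility; characteristic
zero fields are infinite).

§2 discharges the two finite-dimensionality facts of `SchurWeylPlethysm.lean`,
`finiteDimensional_highestWeightSpace_coordRep` and
`finiteDimensional_highestWeightSpace_orbitCoordRep` ("a weight pins the degree", BLMW 2011 §4.4,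
§5.2): torus weight vectors of `k[Sym^m]` are combinations of monomials of that weight
(`monWeight_eq_of_mem_weightSpace`, `PlethysmLifting.lean`), hence lie in the finite-dimensional
piece of the degree pinned by the weight; for the coordinate ring of an orbit closure, the parts of
a semi-invariant class of the other torus weights lie in the (torus-stable) vanishing ideal
(`sum_filter_monWeight_mem_orbitVanishingIdeal`, independence of characters tested against
functionals vanishing on the ideal).

## References

* P. Bürgisser, J.M. Landsberg, L. Manivel, J. Weyman, SIAM J. Comput. 40 (2011), §5.2, (5.2.2)
  (key `BurgisserEtAl2011`).
-/

namespace Literature.NumberTheory.DiophantineGeometry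

open MvPolynomial

variable {k : Type*} [Field k]

/-- **Discharge of `exists_eq_toMatIdx_of_hasHighestWeight_detOrbitRep`.** In characteristic
zero, every highest weight of `k[Δ(det_m)]` is the transported dual weight of a partition
`λ ⊢ m·d` with at most `m²` parts. BLMW 2011 §5.2, (5.2.2). [cite: BurgisserEtAl2011, (5.2.2)] -/
theorem exists_eq_toMatIdx_of_hasHighestWeight_detOrbitRep_holds :
    exists_eq_toMatIdx_of_hasHighestWeight_detOrbitRep (k := k) := by
  intro _ m χ h
  change HasHighestWeight (Literature.Computability.AlgebraicComplexity.orbitCoordRep (detFormLex k m) m) χ at h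
  obtain ⟨D, lam, hlamN, hlam⟩ :=
    Literature.Computability.AlgebraicComplexity.exists_eq_dualOfPartition_of_hasHighestWeight_orbitCoordRep (matIdxEquiv m) _ h
  refine ⟨D, ⟨lam.parts, lam.parts_pos, by rw [lam.parts_sum, mul_comm]⟩, hlamN, ?_⟩
  rw [hlam]
  rfl

/-- The same for the padded permanent (any padding size `n`, G20's `paddedPerOrbitRep`): every
highest weight of `k[Δ(X₀₀^{m-n} per_n)]` is the transported dual weight of a partition `λ ⊢ m·d`
with at most `m²` parts (characteristic zero). BLMW 2011 §5.2, (5.2.2).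
[cite: BurgisserEtAl2011, (5.2.2)] -/
theorem exists_eq_toMatIdx_of_hasHighestWeight_paddedPerOrbitRep [CharZero k] {n m : ℕ}
    [NeZero m] {χ : Weight (MatIdx m)} (h : HasHighestWeight (paddedPerOrbitRep k n m) χ) :
    ∃ (d : ℕ) (lam : Nat.Partition (m * d)), lam.parts.card ≤ m * m ∧
      χ = (Weight.dualOfPartition (m * m) lam).toMatIdx := by
  change HasHighestWeight (Literature.Computability.AlgebraicComplexity.orbitCoordRep (paddedPerFormLex k n m) m) χ at h
  obtain ⟨D, lam, hlamN, hlam⟩ :=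
    Literature.Computability.AlgebraicComplexity.exists_eq_dualOfPartition_of_hasHighestWeight_orbitCoordRep (matIdxEquiv m) _ h
  refine ⟨D, ⟨lam.parts, lam.parts_pos, by rw [lam.parts_sum, mul_comm]⟩, hlamN, ?_⟩
  rw [hlam]
  rfl

/-! ### A weight pins the degree: highest-weight spaces of `k[Sym^m]` and `k[Δ_m[f]]` are
finite-dimensional (discharge of the two `SchurWeylPlethysm` facts) -/

section FiniteDimensional

variable {σ : Type*} [Fintype σ] [LinearOrder σ]

/-- Torus weight vectors of `k[Sym^m]` of weight `χ` have total degree `≤ (-|χ|)/m`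
(`m ≠ 0`; in fact every monomial has exactly this degree, `monWeight_eq_of_mem_weightSpace`).
BLMW 2011 §4.4. [cite: BurgisserEtAl2011, §4.4] -/
theorem weightSpace_coordRep_le_restrictTotalDegree [Infinite k] {m : ℕ} (hm : m ≠ 0)
    (χ : Weight σ) :
    weightSpace (Literature.Computability.AlgebraicComplexity.coordRep σ k m) χ ≤
      restrictTotalDegree (Literature.Computability.AlgebraicComplexity.DegIdx σ m) k ((-χ.size).toNat / m) := by
  classical
  intro F hF
  rw [mem_restrictTotalDegree, totalDegree]
  refine Finset.sup_le fun s hs => ?_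
  have hw := Literature.Computability.AlgebraicComplexity.monWeight_eq_of_mem_weightSpace hF hs
  have hsize := Literature.Computability.AlgebraicComplexity.size_monWeight s
  rw [hw] at hsize
  have h1 : (-χ.size).toNat = m * s.degree := by rw [hsize, neg_neg, Int.toNat_natCast]
  rw [h1, Nat.mul_div_cancel_left _ (Nat.pos_of_ne_zero hm), Finsupp.degree_apply]
  exact le_of_eq rfl

/-- **Discharge of `finiteDimensional_highestWeightSpace_coordRep`** (BLMW 2011 §4.4: a weight
pins the degree, so highest-weight spaces of `k[Sym^m (k^σ)]`, `m ≠ 0`, over an infinite field are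
finite-dimensional). [cite: BurgisserEtAl2011, §4.4] -/
theorem finiteDimensional_highestWeightSpace_coordRep_holds :
    finiteDimensional_highestWeightSpace_coordRep (k := k) (σ := σ) := by
  intro _ m hm χ
  exact Submodule.finiteDimensional_of_le ((highestWeightSpace_le_weightSpace _ _).trans
    (weightSpace_coordRep_le_restrictTotalDegree hm χ))

/-- The part of `F ∈ k[Sym^m]` of torus weight `ψ`: the sum of its monomials of weight `ψ`
(written inline as a filtered sum). For a semi-invariant modulo the `GL`-stable ideal
`I(GL · f)`, the parts of weight `ψ ≠ χ` lie in the ideal (independence of characters tested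
against functionals vanishing on the ideal). [folklore] -/
theorem sum_filter_monWeight_mem_orbitVanishingIdeal [Infinite k] {m : ℕ} (f : MvPolynomial σ k)
    {χ : Weight σ} {F : MvPolynomial (Literature.Computability.AlgebraicComplexity.DegIdx σ m) k}
    (hF : ∀ t : GL σ k, IsDiagonalGL t →
      Literature.Computability.AlgebraicComplexity.coordSubst m t F - weightChar χ t • F ∈ Literature.Computability.AlgebraicComplexity.orbitVanishingIdeal f m)
    {ψ : Weight σ} (hψ : ψ ≠ χ) :
    ∑ s ∈ F.support.filter (fun s => Literature.Computability.AlgebraicComplexity.monWeight s = ψ), monomial s (coeff s F) ∈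
      Literature.Computability.AlgebraicComplexity.orbitVanishingIdeal f m := by
  classical
  set I : Submodule k (MvPolynomial (Literature.Computability.AlgebraicComplexity.DegIdx σ m) k) :=
    (Literature.Computability.AlgebraicComplexity.orbitVanishingIdeal f m).restrictScalars k with hI
  set part : Weight σ → MvPolynomial (Literature.Computability.AlgebraicComplexity.DegIdx σ m) k := fun v =>
    ∑ s ∈ F.support.filter (fun s => Literature.Computability.AlgebraicComplexity.monWeight s = v), monomial s (coeff s F) with hpart
  change part ψ ∈ I
  by_contra hnot
  obtain ⟨L, hL, hLI⟩ := Submodule.exists_dual_map_eq_bot_of_notMem hnot inferInstance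
  have hLI' : ∀ G, G ∈ I → L G = 0 := fun G hG => by
    have : L G ∈ I.map L := Submodule.mem_map_of_mem hG
    rw [hLI] at this
    exact (Submodule.mem_bot k).mp this
  -- weights occurring, plus `χ`
  set W : Finset (Weight σ) := insert χ (F.support.image Literature.Computability.AlgebraicComplexity.monWeight) with hW
  have hmaps : ∀ s ∈ F.support, Literature.Computability.AlgebraicComplexity.monWeight s ∈ W := fun s hs =>
    Finset.mem_insert_of_mem (Finset.mem_image_of_mem _ hs)
  have hFsum : F = ∑ v ∈ W, part v := by
    conv_lhs => rw [← F.support_sum_monomial_coeff]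
    exact (Finset.sum_fiberwise_of_maps_to hmaps _).symm
  have htF : ∀ t : GL σ k, IsDiagonalGL t → Literature.Computability.AlgebraicComplexity.coordSubst m t F = ∑ v ∈ W, weightChar v t • part v := by
    intro t ht
    conv_lhs => rw [hFsum, map_sum]
    refine Finset.sum_congr rfl fun v _ => ?_
    rw [hpart, map_sum, Finset.smul_sum]
    refine Finset.sum_congr rfl fun s hs => ?_
    rw [Literature.Computability.AlgebraicComplexity.coordSubst_monomial_of_isDiagonalGL ht, (Finset.mem_filter.mp hs).2]
  -- the character relation obtained by applying `L`
  have hψW : ψ ∈ W := by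
    by_contra hψW
    apply hL
    have hempty : F.support.filter (fun s => Literature.Computability.AlgebraicComplexity.monWeight s = ψ) = ∅ :=
      Finset.filter_false_of_mem fun s hs hsv => hψW (hsv ▸ hmaps s hs)
    change L (∑ s ∈ F.support.filter (fun s => Literature.Computability.AlgebraicComplexity.monWeight s = ψ), monomial s (coeff s F)) = 0
    rw [hempty, Finset.sum_empty, map_zero]
  have key := Literature.Computability.AlgebraicComplexity.eq_zero_of_sum_mul_weightChar_eq_zero (k := k) W
    (Function.update (fun v => L (part v)) χ (-(∑ w ∈ W.erase χ, L (part w)))) (fun t ht => by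
      have h0 := hLI' _ (hF t ht)
      rw [htF t ht, hFsum, Finset.smul_sum, ← Finset.sum_sub_distrib, map_sum] at h0
      simp only [← sub_smul, map_smul, smul_eq_mul] at h0
      -- `h0 : ∑ v ∈ W, (weightChar v t - weightChar χ t) * L (part v) = 0`
      rw [← Finset.add_sum_erase W _ (Finset.mem_insert_self χ _)] at h0 ⊢
      rw [sub_self, zero_mul, zero_add] at h0
      rw [Function.update_self, neg_mul, Finset.sum_mul, ← Finset.sum_neg_distrib,
        ← Finset.sum_add_distrib, ← h0]
      refine Finset.sum_congr rfl fun v hv => ?_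
      rw [Function.update_of_ne (Finset.ne_of_mem_erase hv)]
      ring)
    ψ hψW
  rw [Function.update_of_ne hψ] at key
  exact hL key

/-- **Discharge of `finiteDimensional_highestWeightSpace_orbitCoordRep`** (BLMW 2011 §5.2): for
`m ≠ 0` over an infinite field the highest-weight spaces of the coordinate ring of an orbit closure
are finite-dimensional — a semi-invariant class is the class of its part of torus weight `χ`, a form
of the degree pinned by `χ`. [cite: BurgisserEtAl2011, §5.2] -/
theorem finiteDimensional_highestWeightSpace_orbitCoordRep_holds :
    finiteDimensional_highestWeightSpace_orbitCoordRep (k := k) (σ := σ) := by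
  intro _ f m hm χ
  classical
  set D := (-χ.size).toNat / m with hD
  set mkL : MvPolynomial (Literature.Computability.AlgebraicComplexity.DegIdx σ m) k →ₗ[k] Literature.Computability.AlgebraicComplexity.OrbitCoordRing f m :=
    (Ideal.Quotient.mkₐ k (Literature.Computability.AlgebraicComplexity.orbitVanishingIdeal f m)).toLinearMap with hmkL
  suffices hle : highestWeightSpace (Literature.Computability.AlgebraicComplexity.orbitCoordRep f m) χ ≤
      (restrictTotalDegree (Literature.Computability.AlgebraicComplexity.DegIdx σ m) k D).map mkL from Submodule.finiteDimensional_of_le hle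
  intro x hx
  obtain ⟨F, rfl⟩ := Ideal.Quotient.mk_surjective x
  have hF : ∀ b : GL σ k, IsUpperTriangular b →
      Literature.Computability.AlgebraicComplexity.coordSubst m b F - weightChar χ b • F ∈ Literature.Computability.AlgebraicComplexity.orbitVanishingIdeal f m := by
    intro b hb
    rw [← Ideal.Quotient.eq]
    have h := hx b hb
    rw [Literature.Computability.AlgebraicComplexity.orbitCoordRep_apply, Literature.Computability.AlgebraicComplexity.orbitCoordSubst_mk] at h
    rw [h]
    exact (map_smul (Ideal.Quotient.mkₐ k (Literature.Computability.AlgebraicComplexity.orbitVanishingIdeal f m)) (weightChar χ b) F).symm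
  -- the part of weight `χ`
  set Fχ : MvPolynomial (Literature.Computability.AlgebraicComplexity.DegIdx σ m) k :=
    ∑ s ∈ F.support.filter (fun s => Literature.Computability.AlgebraicComplexity.monWeight s = χ), monomial s (coeff s F) with hFχ
  have hdiff : F - Fχ ∈ Literature.Computability.AlgebraicComplexity.orbitVanishingIdeal f m := by
    set W : Finset (Weight σ) := insert χ (F.support.image Literature.Computability.AlgebraicComplexity.monWeight) with hW
    have hmaps : ∀ s ∈ F.support, Literature.Computability.AlgebraicComplexity.monWeight s ∈ W := fun s hs =>
      Finset.mem_insert_of_mem (Finset.mem_image_of_mem _ hs)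
    have hFsum : F = ∑ v ∈ W, ∑ s ∈ F.support.filter (fun s => Literature.Computability.AlgebraicComplexity.monWeight s = v),
        monomial s (coeff s F) := by
      conv_lhs => rw [← F.support_sum_monomial_coeff]
      exact (Finset.sum_fiberwise_of_maps_to hmaps _).symm
    have hsplit : F - Fχ = ∑ v ∈ W.erase χ, ∑ s ∈ F.support.filter (fun s => Literature.Computability.AlgebraicComplexity.monWeight s = v),
        monomial s (coeff s F) := by
      rw [sub_eq_iff_eq_add, hFχ, Finset.sum_erase_add _ _ (Finset.mem_insert_self χ _), ← hFsum]
    rw [hsplit]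
    exact Ideal.sum_mem _ fun v hv =>
      sum_filter_monWeight_mem_orbitVanishingIdeal f (fun t ht => hF t ht.isUpperTriangular)
        (Finset.ne_of_mem_erase hv)
  refine ⟨Fχ, ?_, ?_⟩
  · -- `Fχ` has total degree `≤ D`: its monomials have weight `χ`, hence degree `D`
    change Fχ ∈ restrictTotalDegree (Literature.Computability.AlgebraicComplexity.DegIdx σ m) k D
    rw [mem_restrictTotalDegree, hFχ]
    refine (totalDegree_finsetSum _ _).trans (Finset.sup_le fun s hs => ?_)
    refine (totalDegree_monomial_le _ _).trans (le_of_eq ?_)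
    have hw := (Finset.mem_filter.mp hs).2
    have hsize := Literature.Computability.AlgebraicComplexity.size_monWeight s
    rw [hw] at hsize
    have h1 : (-χ.size).toNat = m * s.degree := by rw [hsize, neg_neg, Int.toNat_natCast]
    rw [hD, h1, Nat.mul_div_cancel_left _ (Nat.pos_of_ne_zero hm), Finsupp.degree_apply]
    rfl
  · change Ideal.Quotient.mk _ Fχ = Ideal.Quotient.mk _ F
    exact (Ideal.Quotient.eq.mpr hdiff).symm

end FiniteDimensional

end Literature.NumberTheory.DiophantineGeometry
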